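import Summits.BirchSwinnertonDyer.Rank1Residual.X11b.Three.HsiehDescentOfReciprocity
import Summits.BirchSwinnertonDyer.Rank1Residual.X11b.PadicSemiInvariant
import Summits.BirchSwinnertonDyer.Rank1Residual.X11b.UnramifiedInertiaFixed
import HarnessLib

/-!
# X11b @ `p = 3`, S29 TERMINAL FORM: `(VR) → Three.HsiehDescentAt₃ W` IN THE KERNEL

HONEST FRAMING (cell `b2b-bsdres`, run/shared/lean/b2b/bsd-rank1-residual/, verbatim in every
file): the goal of the cell is to DELETE the COMBINATION-SHAPED residual classes of the
Birch–Swinnerton-Dyer formula for ALL analytic-rank `≤ 1` elliptic curves over `ℚ` — assembled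
STRICTLY from published theorems — so that the rank-`≤ 1` remainder becomes exactly the
CONSTRUCTION-SHAPED classes, which are TYPED, NOT attempted. This is not "finishing BSD". Team N8/O2
(X11b at `3`: `3 ‖ N`, `r_an = 1`, `E[3]` irreducible); deal S29 (x11b3-lead GEN 8, OWNERS R9-8 …
R9-53; lead GEN 9 R10-1 (c)(2) / R10-3: "S29 TERMINAL COROLLARY = GO"); seat `b2b-bsdres-x11b3-p5`
(gen. 6), filing the "unconditional-in-K3 corollary" announced by the K4 owner x11b3-p7 (INBOX
l.5313) under p7's reserved name.  **S29 TERMINAL FORM: `(VR) → HsiehDescentAt₃ W` in the kernel;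
(VR) OPEN = (t) re-expressed (H45); node unchanged; nothing booked.**
WORDING OF RECORD (H45, R9-8): **S29 RE-EXPRESSES (t) ⟸ (VR).** This file is CONDITIONAL on the ONE
labelled hypothesis of record `hVR` (x11b3-r1's `K4InlineShape` antecedent v3 b0483be8996ed870, an
ASSEMBLED consequence of the literature, NOT a printed theorem, NOT discharged here); the two
K3 inputs of `Three.hsiehDescentAt₃_of_valueReciprocity` are now TREE THEOREMS, supplied BY NAME:
`hSen := PadicSemiInvariant.apply_eq_zero_of_forall_exists_semiInvariant` (x11b3-p1, p284961, fed by
`PadicInertiaCharacter.exists_continuousMonoidHom_factor`, p281856) and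
`hUnr := UnramifiedInertia.apply_symm_eq_of_forall_rootsOfUnity_of_ramificationIdx_eq_one 3`
(x11b3-p5, p286034).  The node `Three.HsiehDescentAt₃` is UNCHANGED — no `_holds`, nothing appended,
nothing booked, no mark / label / count / tier moved; O2 OPEN / N8 CONSTRUCTION.  THEOREM ONLY (no
definition, no named fact, no `sorry`).

* `Three.hsiehDescentAt₃_of_valueReciprocity' : hVR → HsiehDescentAt₃ W` — `hVR` VERBATIM as
  in `Three.hsiehDescentAt₃_of_valueReciprocity` (p286080); the tree's Prop-valued local-field
  structure on `ℚ_[3]` is introduced inside the proof (`Padic.isNonarchimedeanLocalField_holds 3`).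

References: as in `X11b/Three/HsiehDescentOfReciprocity.lean` ([Hsieh2014], [CastellaHsieh2018],
[Tate1967]); Serre, *Local Fields* XIV §7 Thm. 2 and IV §4 (the two K3 inputs).
-/

noncomputable section

open scoped NumberField Topology
open Filter NumberField IsDedekindDomain Field PowerSeries WeierstrassCurve
open Literature.NumberTheory.GaloisRepresentations Literature.NumberTheory.EllipticCurves
open Literature.NumberTheory.EllipticCurves.ModularForms
open Summit.BirchSwinnertonDyer.Rank1Residual.X11b.LambdaSupply
open Summit.BirchSwinnertonDyer.Rank1Residual.X11b.Three.LambdaSupply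
open Summit.BirchSwinnertonDyer.Rank1Residual.X11b.Three.RangeTransport

namespace Summit.BirchSwinnertonDyer.Rank1Residual.X11b.Three

variable (W : WeierstrassCurve ℚ) [W.IsElliptic]

/-- **S29 TERMINAL FORM — `Three.HsiehDescentAt₃ W` from (VR) alone**: the K4 assembly
`Three.hsiehDescentAt₃_of_valueReciprocity` (x11b3-p7) with its two K3 inputs supplied BY NAME —
`hSen` = local Kronecker–Weber + Lang + Tate
(`PadicSemiInvariant.apply_eq_zero_of_forall_exists_semiInvariant`, x11b3-p1, every `p`, here
`p := 3`) and `hUnr` = T6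
(`UnramifiedInertia.apply_symm_eq_of_forall_rootsOfUnity_of_ramificationIdx_eq_one 3`, x11b3-p5).
CONDITIONAL on the labelled hypothesis of record `hVR` (value reciprocity (VR-A)+(VR-B), r1 binder
v3 VERBATIM as in p286080; an ASSEMBLED consequence, NOT a printed theorem, NOT discharged) —
S29 RE-EXPRESSES (t) ⟸ (VR); the node `Three.HsiehDescentAt₃` is UNCHANGED and NOT supplied;
nothing booked; no mark / label / count / tier moved.
[cite: Hsieh2014, Thm. 1 (arXiv:1112.1580 pp. 3–4)]
[cite: SerreLocalFields1979, Ch. XIV §7 Thm. 2] -/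
theorem hsiehDescentAt₃_of_valueReciprocity'
    (hVR :
  (∀ (K : Type) [Field K] [NumberField K] (𝔭 : HeightOneSpectrum (𝓞 K)) {N : ℕ} [NeZero N]
      (f : CuspForm (CongruenceSubgroup.Gamma0 N) 2),
      IsNewformOf W f → W.conductorNorm ℤ = N → IsImaginaryQuadratic K → SatisfiesHeegnerHypothesis N K →
      ((Ideal.span {(3 : ℤ)}).primesOver (𝓞 K)).ncard = 2 → ((3 : ℕ) : 𝓞 K) ∈ 𝔭.asIdeal →
      ∃ Ω : ℂ, Ω ≠ 0 ∧
        -- (VR-A) cocycle clause on Aut(ℂ/K); ideal slot = integer-exponent monomial at primes v ∤ 3 (F-i)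
        (∀ σ : ℂ ≃ₐ[ℚ] ℂ, (∀ (φ : K →+* ℂ) (k : K), σ (φ k) = φ k) →
          ∃ (c d : ℂ) (e : HeightOneSpectrum (𝓞 K) →₀ ℤ), c ≠ 0 ∧ d ≠ 0 ∧
            (∀ v ∈ e.support, ((3 : ℕ) : 𝓞 K) ∉ v.asIdeal) ∧
            ∀ (χ : HeckeCharacter K) (n : ℕ), 0 < n →
              (∀ v : HeightOneSpectrum (𝓞 K), χ.IsUnramifiedAt v) →
              ∀ hχ : χ.HasInfinityType (fun _ ↦ (n : ℤ)) (fun _ ↦ -(n : ℤ)),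
                σ (bdpInterpolationValue 3 f 𝔭 χ n Ω) =
                  d * c ^ n * (e.prod fun v k ↦ (hχ.autConj σ).valueAtUniformizer v ^ k) *
                    bdpInterpolationValue 3 f 𝔭 (hχ.autConj σ) n Ω) ∧
        -- (VR-B) exactness clause on Aut(ℂ/F), F ⊇ K a number field unramified above 3
        (∃ F : IntermediateField ℚ ℂ, FiniteDimensional ℚ F ∧
          (∀ (φ : K →+* ℂ) (k : K), φ k ∈ F) ∧
          (∀ P : Ideal (𝓞 F), P.IsPrime → ((3 : ℕ) : 𝓞 F) ∈ P → P.ramificationIdx (𝓞 ℚ) = 1) ∧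
          ∀ σ : ℂ ≃ₐ[ℚ] ℂ, (∀ x : ℂ, x ∈ F → σ x = x) →
            ∀ (χ : HeckeCharacter K) (n : ℕ), 0 < n →
              (∀ v : HeightOneSpectrum (𝓞 K), χ.IsUnramifiedAt v) →
              ∀ hχ : χ.HasInfinityType (fun _ ↦ (n : ℤ)) (fun _ ↦ -(n : ℤ)),
                σ (bdpInterpolationValue 3 f 𝔭 χ n Ω) =
                  bdpInterpolationValue 3 f 𝔭 (hχ.autConj σ) n Ω))) :
    HsiehDescentAt₃ W := by
  haveI : IsNonarchimedeanLocalField ℚ_[3] :=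
    Literature.NumberTheory.GaloisRepresentations.Padic.isNonarchimedeanLocalField_holds 3
  exact hsiehDescentAt₃_of_valueReciprocity W hVR
    (fun T hT hTτ => PadicSemiInvariant.apply_eq_zero_of_forall_exists_semiInvariant T hT hTτ)
    (UnramifiedInertia.apply_symm_eq_of_forall_rootsOfUnity_of_ramificationIdx_eq_one 3)

end Summit.BirchSwinnertonDyer.Rank1Residual.X11b.Three
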